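import Literature.NumberTheory.Automorphic.UnitaryCurveCohCotangentForms
import Literature.AlgebraicGeometry.ShimuraVarieties.HermitianNegConeOrbitDensity
import Mathlib.Analysis.Normed.Algebra.MatrixExponential
import HarnessLib

/-!
# The cone extension of a cotangent-type function on `U(σ_{w₁}J)(ℂ)` (rank `2`): from the `K_∞`-law on the group to the
# cotangent law on the cone-open `{g ∈ GL₂(ℂ) | g v₀ negative}`

Topic `AlgebraicGeometry/ShimuraVarieties`; namespace `Literature.AlgebraicGeometry.ShimuraVarieties.UnitaryCurveCone`.
THEOREMS ONLY (no `def`, no instance, no notation, no named fact, no `sorry`); imports ★ `UnitaryCurveCohCotangentForms`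
(`ConeFrame`, `IsConeHol`, `archLocal`), ★ `HermitianNegConeOrbitDensity` §1 (hermitian-form identities, Witt transitivity on
negative lines), Mathlib `MatrixExponential`.

SETTING.  `E` a number field, `J ∈ M₂(E)`, `w₁` a complex place, `Jw := σ_{w₁} J ∈ M₂(ℂ)` HERMITIAN, and a cone frame
`𝔣 = (v₀, t₀)` (★ `ConeFrame`: `v₀` negative, `t₀` positive, `⟪t₀, v₀⟫ = 0` for `⟪x, y⟫ = xᴴ Jw y`); `U := archLocal E 2 J w₁ =
U(Jw) ≤ GL₂(ℂ)`.  The pair `(t₀, v₀)` is a basis of `ℂ²` (§1), so every matrix `b` stabilising the line `ℂ v₀` has FRAME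
COORDINATES `b v₀ = k v₀`, `b t₀ = a t₀ + d v₀`; the COTANGENT CHARACTER is `λ(b) = a k⁻¹` — the factor of the cone law of ★
`IsConeHol` («`Φ (g b) = (a k⁻¹) Φ g`»), multiplicative in `b` (§2).  The CONE-OPEN `Ω = {g | IsUnit g ∧ g v₀ ∈ negCone Jw}`
is `U · Stab(ℂ v₀)` (§4, by Witt transitivity ★ `exists_unitary_mulVec_eq_smul_of_mem_negCone`), and `U ∩ Stab(ℂ v₀) = K_∞`
(the compact torus fixing the point `[v₀]` of the disc of negative lines).

MAIN RESULTS.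
* §3 `conjTranspose_exp_mul_mul_exp_eq` — `Xᴴ Jc + Jc X = 0 ⇒ (exp X)ᴴ Jc (exp X) = Jc` for ANY invertible `Jc` (rank-free twin of ★
  `BallForms.exp_mem_U21`), `isUnit_map_embedding_of_coneFrame` (`Jw` is invertible), and `exists_expFamily_archLocal`: for an
  `ℝ`-linear `X : ℂ → 𝔲(Jw)` there is `γ : ℂ → U` with `γ z = exp (X z)` as matrices.
* §3 `exists_coneProbe` — THE `𝔭`-PROBE OF THE FRAME: an `ℝ`-linear `X : ℂ →ₗ[ℝ] M₂(ℂ)` with `X z ∈ 𝔲(Jw)`, `X z · v₀ = z • t₀`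
  and `X z · t₀ ∈ ℂ v₀` (explicitly `X z = ⟪v₀,v₀⟫⁻¹ (z • t₀ (v₀ᴴ Jw) − z̄ • v₀ (t₀ᴴ Jw))`; its `ℂ`-linear half `v₀ ↦ z t₀` spans
  the tangent line of the disc at `[v₀]`, its antilinear half `t₀ ↦ −z̄ ⟪t₀,t₀⟫∕⟪v₀,v₀⟫ · v₀` lies in `Lie Stab(ℂ v₀)` and is unipotent).
* §5 **`exists_coneExtension`** — every `φ : U → ℂ` obeying the cotangent `K_∞`-LAW `φ (u κ) = (a k⁻¹) φ u` (`κ ∈ U`, `κ v₀ = k v₀`,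
  `κ t₀ = a t₀ + d v₀`) is the restriction of a function `Φ : M₂(ℂ) → ℂ` obeying the FULL CONE LAW of ★ `IsConeHol 𝔣` (second
  clause, verbatim) — `Φ (u b) := λ(b) φ(u)`, well defined because two factorisations differ by an element of `K_∞` and `λ` is
  multiplicative (§2 `frame_coords_mul`); on non-units `Φ := 0`, which is what the cone law forces when `a = 0`.
This is the ALGEBRAIC half of the rank-2 cone dictionary «cotangent-type functions on the group with holomorphic germs ↔ `IsConeHol`
functions on the cone» (Borel (1997) §5.13–§5.14: automorphic forms of weight `m` on `SL₂(ℝ)` ↔ functions on the upper half plane via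
the automorphy factor; here frame-free, for an arbitrary signature-`(1,1)` hermitian form, read on the cone over the disc as in
Bergeron–Millson–Moeglin (2016) Part 2 §1.3); the ANALYTIC half (Cauchy–Riemann along the probe ⇒ holomorphy on the cone) is the
sequel `UnitaryCurveConeHolomorphyOfCR`.  Cell `hodgecm-mathlib`, floor 0, K-groundwork for the P5 named fact TP₂ (rank-2 spectral
projection); seat A-p14 (g16).  HC_CM is proved only modulo the printed citations until rung 0 closes; nothing printed is asserted here.

## References
* [Borel1997] A. Borel, *Automorphic forms on SL₂(ℝ)*, Cambridge Tracts in Math. 130 (1997), §5.13–§5.14.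
* [BergeronMillsonMoeglin2016Balls] N. Bergeron, J. Millson, C. Moeglin, Acta Math. 216 (2016), Part 2 §1.3.
* [Jacobson] N. Jacobson, *Basic Algebra I*, 2nd ed. (1985), Ch. V §11 (Witt's theorem).
* [Hall2015] B. Hall, *Lie Groups, Lie Algebras, and Representations*, 2nd ed., GTM 222 (2015), Prop. 2.3–2.4, §3.4 (matrix
  exponential and the Lie algebras of the classical groups).
-/

set_option autoImplicit false

noncomputable section

open Matrix NumberField NumberField.InfinitePlace
open scoped Matrix ComplexConjugate ComplexOrder
open Literature.NumberTheory.Automorphic Literature.NumberTheory.Automorphic.UnitaryGroup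
open Literature.NumberTheory.Automorphic.UnitaryCurveForms

namespace Literature.AlgebraicGeometry.ShimuraVarieties.UnitaryCurveCone

variable {E : Type} [Field E] {J : Matrix (Fin 2) (Fin 2) E} {w₁ : {w : InfinitePlace E // IsComplex w}}

/-! ### §1. The frame `(t₀, v₀)` is a `Jw`-orthogonal basis of `ℂ²` -/

section Frame

variable (𝔣 : ConeFrame E J w₁)

/-- `⟪v₀, v₀⟫ ≠ 0` (it has negative real part). [cite: BergeronMillsonMoeglin2016Balls, Part 2 §1.3] -/
theorem form_v₀_ne_zero : star 𝔣.v₀ ⬝ᵥ (J.map w₁.1.embedding *ᵥ 𝔣.v₀) ≠ 0 := by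
  intro h
  have hv := mem_negCone_iff.1 𝔣.v₀_mem
  rw [h, Complex.zero_re] at hv
  exact lt_irrefl _ hv

/-- `⟪t₀, t₀⟫ ≠ 0` (it has positive real part). [cite: BergeronMillsonMoeglin2016Balls, Part 2 §1.3] -/
theorem form_t₀_ne_zero : star 𝔣.t₀ ⬝ᵥ (J.map w₁.1.embedding *ᵥ 𝔣.t₀) ≠ 0 := by
  intro h
  have ht := 𝔣.t₀_pos
  rw [h, Complex.zero_re] at ht
  exact lt_irrefl _ ht

/-- `⟪v₀, t₀⟫ = 0` (the hermitian transpose of the frame's orthogonality). [cite: Jacobson, Ch. V §7 pp. 150–151] -/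
theorem form_v₀_t₀ (hJ : (J.map w₁.1.embedding).IsHermitian) : star 𝔣.v₀ ⬝ᵥ (J.map w₁.1.embedding *ᵥ 𝔣.t₀) = 0 := by
  rw [← star_star_dotProduct_mulVec hJ, 𝔣.orth, star_zero]

/-- `v₀ ≠ 0`. [cite: BergeronMillsonMoeglin2016Balls, Part 2 §1.3] -/
theorem v₀_ne_zero : 𝔣.v₀ ≠ 0 := by
  intro h
  apply form_v₀_ne_zero 𝔣
  rw [h, mulVec_zero, dotProduct_zero]

/-- `t₀ ≠ 0`. [cite: BergeronMillsonMoeglin2016Balls, Part 2 §1.3] -/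
theorem t₀_ne_zero : 𝔣.t₀ ≠ 0 := by
  intro h
  apply form_t₀_ne_zero 𝔣
  rw [h, mulVec_zero, dotProduct_zero]

/-- **Uniqueness of frame coordinates**: `a t₀ + d v₀ = a' t₀ + d' v₀ ⇒ a = a' ∧ d = d'` (pair the identity with `v₀` and with
`t₀` under the hermitian form). [cite: Jacobson, Ch. V §7 pp. 150–151] -/
theorem frame_coords_unique (hJ : (J.map w₁.1.embedding).IsHermitian) {a d a' d' : ℂ}
    (h : a • 𝔣.t₀ + d • 𝔣.v₀ = a' • 𝔣.t₀ + d' • 𝔣.v₀) : a = a' ∧ d = d' := by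
  have hv₀ := form_v₀_ne_zero 𝔣
  have ht₀ := form_t₀_ne_zero 𝔣
  have h1 := congrArg (fun w => star 𝔣.t₀ ⬝ᵥ (J.map w₁.1.embedding *ᵥ w)) h
  have h2 := congrArg (fun w => star 𝔣.v₀ ⬝ᵥ (J.map w₁.1.embedding *ᵥ w)) h
  simp only [mulVec_add, mulVec_smul, dotProduct_add, dotProduct_smul, smul_eq_mul, 𝔣.orth, form_v₀_t₀ 𝔣 hJ,
    mul_zero, add_zero, zero_add] at h1 h2
  exact ⟨mul_right_cancel₀ ht₀ h1, mul_right_cancel₀ hv₀ h2⟩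

/-- The frame is linearly independent. [cite: Jacobson, Ch. V §7 pp. 150–151] -/
theorem linearIndependent_frame (hJ : (J.map w₁.1.embedding).IsHermitian) : LinearIndependent ℂ ![𝔣.t₀, 𝔣.v₀] := by
  rw [LinearIndependent.pair_iff]
  intro a d h
  have h' : a • 𝔣.t₀ + d • 𝔣.v₀ = (0 : ℂ) • 𝔣.t₀ + (0 : ℂ) • 𝔣.v₀ := by rw [h, zero_smul, zero_smul, add_zero]
  exact frame_coords_unique 𝔣 hJ h'

/-- **Existence of frame coordinates**: every `w ∈ ℂ²` is `a t₀ + d v₀`. [cite: Jacobson, Ch. V §7 pp. 150–151] -/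
theorem exists_frame_coords (hJ : (J.map w₁.1.embedding).IsHermitian) (w : Fin 2 → ℂ) :
    ∃ a d : ℂ, w = a • 𝔣.t₀ + d • 𝔣.v₀ := by
  have hli := linearIndependent_frame 𝔣 hJ
  have hcard : Fintype.card (Fin 2) = Module.finrank ℂ (Fin 2 → ℂ) := by simp
  let B := basisOfLinearIndependentOfCardEqFinrank hli hcard
  refine ⟨B.repr w 0, B.repr w 1, ?_⟩
  have h := B.sum_repr w
  rw [Fin.sum_univ_two] at h
  have hB0 : B 0 = 𝔣.t₀ := by simp [B]
  have hB1 : B 1 = 𝔣.v₀ := by simp [B]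
  rw [hB0, hB1] at h
  exact h.symm

/-- For any matrix `b`, the frame coordinates of `b t₀` exist. [cite: Jacobson, Ch. V §7 pp. 150–151] -/
theorem exists_frame_coords_mulVec (hJ : (J.map w₁.1.embedding).IsHermitian) (b : Matrix (Fin 2) (Fin 2) ℂ) :
    ∃ a d : ℂ, b *ᵥ 𝔣.t₀ = a • 𝔣.t₀ + d • 𝔣.v₀ :=
  exists_frame_coords 𝔣 hJ _

/-! ### §2. Frame coordinates on `Stab(ℂ v₀)`: products and invertibility -/

/-- **Frame coordinates multiply**: if `b v₀ = k v₀`, `b t₀ = a t₀ + d v₀` and `b' v₀ = k' v₀`, `b' t₀ = a' t₀ + d' v₀`, then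
`(b b') v₀ = (k k') v₀` and `(b b') t₀ = (a a') t₀ + (a' d + d' k) v₀` — so `λ(b) = a k⁻¹` is multiplicative on `Stab(ℂ v₀)`.
[cite: Borel1997, §5.13–§5.14] -/
theorem frame_coords_mul {b b' : Matrix (Fin 2) (Fin 2) ℂ} {k a d k' a' d' : ℂ} (hbv : b *ᵥ 𝔣.v₀ = k • 𝔣.v₀)
    (hbt : b *ᵥ 𝔣.t₀ = a • 𝔣.t₀ + d • 𝔣.v₀) (hb'v : b' *ᵥ 𝔣.v₀ = k' • 𝔣.v₀) (hb't : b' *ᵥ 𝔣.t₀ = a' • 𝔣.t₀ + d' • 𝔣.v₀) :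
    (b * b') *ᵥ 𝔣.v₀ = (k * k') • 𝔣.v₀ ∧ (b * b') *ᵥ 𝔣.t₀ = (a * a') • 𝔣.t₀ + (a' * d + d' * k) • 𝔣.v₀ := by
  refine ⟨?_, ?_⟩
  · rw [← mulVec_mulVec, hb'v, mulVec_smul, hbv, smul_smul, mul_comm]
  · rw [← mulVec_mulVec, hb't, mulVec_add, mulVec_smul, mulVec_smul, hbt, hbv]
    module

/-- A matrix in `Stab(ℂ v₀)` with `a = 0` (`b t₀ ∈ ℂ v₀`) is NOT invertible: `k t₀ − d v₀ ≠ 0` lies in its kernel (when `k ≠ 0`).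
[cite: Jacobson, Ch. V §7 pp. 150–151] -/
theorem not_isUnit_of_frame_coords_zero (hJ : (J.map w₁.1.embedding).IsHermitian) {b : Matrix (Fin 2) (Fin 2) ℂ} {k d : ℂ}
    (hk : k ≠ 0) (hbv : b *ᵥ 𝔣.v₀ = k • 𝔣.v₀) (hbt : b *ᵥ 𝔣.t₀ = (0 : ℂ) • 𝔣.t₀ + d • 𝔣.v₀) : ¬ IsUnit b := by
  intro hu
  have hinj : Function.Injective b.mulVec := Matrix.mulVec_injective_iff_isUnit.2 hu
  have hker : b *ᵥ (k • 𝔣.t₀ - d • 𝔣.v₀) = b *ᵥ 0 := by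
    rw [mulVec_zero, mulVec_sub, mulVec_smul, mulVec_smul, hbt, hbv, zero_smul, zero_add, smul_smul, smul_smul, mul_comm d k,
      sub_self]
  have h0 := hinj hker
  have h' : k • 𝔣.t₀ + (-d) • 𝔣.v₀ = (0 : ℂ) • 𝔣.t₀ + (0 : ℂ) • 𝔣.v₀ := by
    rw [neg_smul, ← sub_eq_add_neg, h0, zero_smul, zero_smul, add_zero]
  exact hk (frame_coords_unique 𝔣 hJ h').1

/-- A matrix in `Stab(ℂ v₀)` with `k ≠ 0` and `a ≠ 0` IS invertible (triangular in the frame basis with non-zero diagonal).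
[cite: Jacobson, Ch. V §7 pp. 150–151] -/
theorem isUnit_of_frame_coords (hJ : (J.map w₁.1.embedding).IsHermitian) {b : Matrix (Fin 2) (Fin 2) ℂ} {k a d : ℂ}
    (hk : k ≠ 0) (ha : a ≠ 0) (hbv : b *ᵥ 𝔣.v₀ = k • 𝔣.v₀) (hbt : b *ᵥ 𝔣.t₀ = a • 𝔣.t₀ + d • 𝔣.v₀) : IsUnit b := by
  rw [← Matrix.mulVec_injective_iff_isUnit]
  intro x y hxy
  obtain ⟨α, β, hx⟩ := exists_frame_coords 𝔣 hJ (x - y)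
  have h0 : b *ᵥ (x - y) = 0 := by rw [mulVec_sub, hxy, sub_self]
  rw [hx, mulVec_add, mulVec_smul, mulVec_smul, hbt, hbv, smul_add, smul_smul, smul_smul, smul_smul] at h0
  have h' : (α * a) • 𝔣.t₀ + (α * d + β * k) • 𝔣.v₀ = (0 : ℂ) • 𝔣.t₀ + (0 : ℂ) • 𝔣.v₀ := by
    rw [zero_smul, zero_smul, add_zero, ← h0, add_smul]; abel
  obtain ⟨h1, h2⟩ := frame_coords_unique 𝔣 hJ h'
  have hα : α = 0 := by
    rcases mul_eq_zero.1 h1 with h | h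
    · exact h
    · exact absurd h ha
  rw [hα, zero_mul, zero_add] at h2
  have hβ : β = 0 := by
    rcases mul_eq_zero.1 h2 with h | h
    · exact h
    · exact absurd h hk
  rw [hα, hβ, zero_smul, zero_smul, add_zero] at hx
  exact sub_eq_zero.1 hx

/-- Frame coordinates of an invertible matrix in `Stab(ℂ v₀)` have `a ≠ 0`. [cite: Jacobson, Ch. V §7 pp. 150–151] -/
theorem frame_coord_ne_zero_of_isUnit (hJ : (J.map w₁.1.embedding).IsHermitian) {b : Matrix (Fin 2) (Fin 2) ℂ} {k a d : ℂ}
    (hk : k ≠ 0) (hbv : b *ᵥ 𝔣.v₀ = k • 𝔣.v₀) (hbt : b *ᵥ 𝔣.t₀ = a • 𝔣.t₀ + d • 𝔣.v₀) (hu : IsUnit b) : a ≠ 0 := by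
  intro ha
  rw [ha] at hbt
  exact not_isUnit_of_frame_coords_zero 𝔣 hJ hk hbv hbt hu

/-- The identity has frame coordinates `k = a = 1`, `d = 0`. [cite: Borel1997, §5.13–§5.14] -/
theorem frame_coords_one : (1 : Matrix (Fin 2) (Fin 2) ℂ) *ᵥ 𝔣.v₀ = (1 : ℂ) • 𝔣.v₀ ∧
    (1 : Matrix (Fin 2) (Fin 2) ℂ) *ᵥ 𝔣.t₀ = (1 : ℂ) • 𝔣.t₀ + (0 : ℂ) • 𝔣.v₀ := by
  rw [one_mulVec, one_mulVec, one_smul, one_smul, zero_smul, add_zero]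
  exact ⟨rfl, rfl⟩

/-! ### §3. The unitary group of the frame's form: preserved form, one-parameter subgroups, the `𝔭`-probe -/

/-- Elements of `U = archLocal E 2 J w₁` preserve the hermitian form: `⟪u x, u y⟫ = ⟪x, y⟫`. [cite: Jacobson, Ch. V §11 p. 162] -/
theorem form_mulVec_mulVec (u : archLocal E 2 J w₁) (x y : Fin 2 → ℂ) :
    star (((u : GL (Fin 2) ℂ) : Matrix (Fin 2) (Fin 2) ℂ) *ᵥ x) ⬝ᵥ
        (J.map w₁.1.embedding *ᵥ (((u : GL (Fin 2) ℂ) : Matrix (Fin 2) (Fin 2) ℂ) *ᵥ y)) =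
      star x ⬝ᵥ (J.map w₁.1.embedding *ᵥ y) := by
  have hu := (mem_archLocal_iff_conjTranspose E 2 J w₁ (u : GL (Fin 2) ℂ)).1 u.2
  conv_rhs => rw [← hu]
  rw [star_mulVec, ← dotProduct_mulVec, mulVec_mulVec, mulVec_mulVec, Matrix.mul_assoc]

/-- `u v₀` is again a negative vector, and `u` is invertible: `U · v₀` lies in the cone-open. [cite: BergeronMillsonMoeglin2016Balls, Part 2 §1.3] -/
theorem isUnit_and_mulVec_mem_negCone (u : archLocal E 2 J w₁) :
    IsUnit (((u : GL (Fin 2) ℂ) : Matrix (Fin 2) (Fin 2) ℂ)) ∧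
      ((u : GL (Fin 2) ℂ) : Matrix (Fin 2) (Fin 2) ℂ) *ᵥ 𝔣.v₀ ∈ negCone (J.map w₁.1.embedding) := by
  refine ⟨Units.isUnit _, ?_⟩
  rw [mem_negCone_iff, form_mulVec_mulVec]
  exact mem_negCone_iff.1 𝔣.v₀_mem

include 𝔣 in
/-- `Jw` is invertible: a vector killed by `Jw` is orthogonal to `t₀` and `v₀`, hence `0`. [cite: Jacobson, Ch. V §7 pp. 150–151] -/
theorem isUnit_form (hJ : (J.map w₁.1.embedding).IsHermitian) : IsUnit (J.map w₁.1.embedding) := by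
  rw [← Matrix.mulVec_injective_iff_isUnit]
  intro x y hxy
  obtain ⟨α, β, hx⟩ := exists_frame_coords 𝔣 hJ (x - y)
  have h0 : J.map w₁.1.embedding *ᵥ (x - y) = 0 := by rw [mulVec_sub, hxy, sub_self]
  have h1 := congrArg (fun w => star 𝔣.t₀ ⬝ᵥ w) h0
  have h2 := congrArg (fun w => star 𝔣.v₀ ⬝ᵥ w) h0
  simp only [hx, mulVec_add, mulVec_smul, dotProduct_add, dotProduct_smul, smul_eq_mul, 𝔣.orth, form_v₀_t₀ 𝔣 hJ,
    dotProduct_zero, mul_zero, add_zero, zero_add] at h1 h2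
  have hα : α = 0 := by
    rcases mul_eq_zero.1 h1 with h | h
    · exact h
    · exact absurd h (form_t₀_ne_zero 𝔣)
  have hβ : β = 0 := by
    rcases mul_eq_zero.1 h2 with h | h
    · exact h
    · exact absurd h (form_v₀_ne_zero 𝔣)
  rw [hα, hβ, zero_smul, zero_smul, add_zero] at hx
  exact sub_eq_zero.1 hx

end Frame

section Exp

open scoped Matrix.Norms.Operator

/-- **One-parameter subgroups**: for an invertible `Jc ∈ M_m(ℂ)` and `X` with `Xᴴ Jc + Jc X = 0`, `(exp X)ᴴ Jc (exp X) = Jc`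
(`(exp X)ᴴ = exp Xᴴ = exp (Jc (−X) Jc⁻¹) = Jc exp(−X) Jc⁻¹`).  Rank-free twin of ★ `BallForms.exp_mem_U21`. [cite: Hall2015, Prop. 2.3–2.4 and §3.4] -/
theorem conjTranspose_exp_mul_mul_exp_eq {m : Type} [Fintype m] [DecidableEq m] {Jc X : Matrix m m ℂ} (hJc : IsUnit Jc)
    (hX : Xᴴ * Jc + Jc * X = 0) : (NormedSpace.exp X)ᴴ * Jc * NormedSpace.exp X = Jc := by
  have hdet : IsUnit Jc.det := (Matrix.isUnit_iff_isUnit_det _).1 hJc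
  have hXH : Xᴴ = Jc * (-X) * Jc⁻¹ := by
    have h1 : Xᴴ * Jc = -(Jc * X) := eq_neg_of_add_eq_zero_left hX
    calc Xᴴ = Xᴴ * (Jc * Jc⁻¹) := by rw [Matrix.mul_nonsing_inv _ hdet, Matrix.mul_one]
      _ = (Xᴴ * Jc) * Jc⁻¹ := by rw [Matrix.mul_assoc]
      _ = Jc * (-X) * Jc⁻¹ := by rw [h1, Matrix.mul_neg, Matrix.neg_mul]
  rw [← Matrix.exp_conjTranspose, hXH, Matrix.exp_conj _ _ hJc]
  calc Jc * NormedSpace.exp (-X) * Jc⁻¹ * Jc * NormedSpace.exp X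
      = Jc * (NormedSpace.exp (-X) * ((Jc⁻¹ * Jc) * NormedSpace.exp X)) := by simp only [Matrix.mul_assoc]
    _ = Jc := by
        rw [Matrix.nonsing_inv_mul _ hdet, Matrix.one_mul, ← Matrix.exp_add_of_commute _ _ ((Commute.refl X).neg_left),
          neg_add_cancel, NormedSpace.exp_zero, Matrix.mul_one]

/-- `exp X` is invertible with inverse `exp (−X)`. [cite: Hall2015, Prop. 2.3–2.4] -/
theorem exp_mul_exp_neg {m : Type} [Fintype m] [DecidableEq m] (X : Matrix m m ℂ) :
    NormedSpace.exp X * NormedSpace.exp (-X) = 1 ∧ NormedSpace.exp (-X) * NormedSpace.exp X = 1 := by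
  refine ⟨?_, ?_⟩
  · rw [← Matrix.exp_add_of_commute _ _ ((Commute.refl X).neg_right), add_neg_cancel, NormedSpace.exp_zero]
  · rw [← Matrix.exp_add_of_commute _ _ ((Commute.refl X).neg_left), neg_add_cancel, NormedSpace.exp_zero]

/-- `(a ⊗ b) v = (b · v) a` for the outer product `vecMulVec a b` over a commutative ring (Mathlib's `vecMulVec_mulVec` is stated
with an opposite-ring scalar). [folklore] -/
private theorem vecMulVec_mulVec_eq_smul {m : Type} [Fintype m] (a b v : m → ℂ) : vecMulVec a b *ᵥ v = (b ⬝ᵥ v) • a := by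
  ext i
  simp [vecMulVec_apply, mulVec, dotProduct, Finset.mul_sum, mul_comm, mul_left_comm]

variable (𝔣 : ConeFrame E J w₁)

include 𝔣 in
/-- **`exp` of the Lie algebra lands in the group, as a family**: for `X : ℂ → M₂(ℂ)` valued in `𝔲(Jw)` there is `γ : ℂ → U`
with `γ z = exp (X z)` as matrices. [cite: Hall2015, Prop. 2.3–2.4 and §3.4] -/
theorem exists_expFamily_archLocal (hJ : (J.map w₁.1.embedding).IsHermitian) (X : ℂ → Matrix (Fin 2) (Fin 2) ℂ)
    (hX : ∀ z, (X z)ᴴ * J.map w₁.1.embedding + J.map w₁.1.embedding * X z = 0) :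
    ∃ γ : ℂ → archLocal E 2 J w₁, ∀ z, ((γ z : GL (Fin 2) ℂ) : Matrix (Fin 2) (Fin 2) ℂ) = NormedSpace.exp (X z) := by
  have hJu := isUnit_form 𝔣 hJ
  refine ⟨fun z => ⟨⟨NormedSpace.exp (X z), NormedSpace.exp (-(X z)), (exp_mul_exp_neg (X z)).1, (exp_mul_exp_neg (X z)).2⟩,
    ?_⟩, fun z => rfl⟩
  rw [mem_archLocal_iff_conjTranspose]
  exact conjTranspose_exp_mul_mul_exp_eq hJu (hX z)

/-- **THE `𝔭`-PROBE OF THE FRAME.**  There is an `ℝ`-linear `X : ℂ → M₂(ℂ)` with values in `𝔲(Jw)` (`(X z)ᴴ Jw + Jw (X z) = 0`) such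
that `X z · v₀ = z • t₀` (the `ℂ`-linear half: the tangent line of the disc of negative lines at `[v₀]` is `Hom(ℂ v₀, ℂ t₀)`) and
`X z · t₀ ∈ ℂ v₀` (the antilinear half, which lies in `Lie Stab(ℂ v₀)` and is unipotent there).  Explicitly
`X z = ⟪v₀,v₀⟫⁻¹ • (z • t₀ ⊗ (v₀ᴴ Jw) − z̄ • v₀ ⊗ (t₀ᴴ Jw))`; the identity `(t₀ ⊗ v₀ᴴJw)ᴴ Jw = Jw (v₀ ⊗ t₀ᴴ Jw)` makes it skew.
[cite: Borel1997, §5.13–§5.14] [cite: BergeronMillsonMoeglin2016Balls, Part 2 §1.3] -/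
theorem exists_coneProbe (hJ : (J.map w₁.1.embedding).IsHermitian) :
    ∃ X : ℂ →ₗ[ℝ] Matrix (Fin 2) (Fin 2) ℂ,
      (∀ z, (X z)ᴴ * J.map w₁.1.embedding + J.map w₁.1.embedding * X z = 0) ∧
      (∀ z, X z *ᵥ 𝔣.v₀ = z • 𝔣.t₀) ∧
      ∀ z, ∃ c : ℂ, X z *ᵥ 𝔣.t₀ = c • 𝔣.v₀ := by
  set Jw := J.map w₁.1.embedding with hJw
  set ν : ℂ := star 𝔣.v₀ ⬝ᵥ (Jw *ᵥ 𝔣.v₀) with hν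
  set π : ℂ := star 𝔣.t₀ ⬝ᵥ (Jw *ᵥ 𝔣.t₀) with hπ
  set T₁ : Matrix (Fin 2) (Fin 2) ℂ := vecMulVec 𝔣.t₀ (star 𝔣.v₀ ᵥ* Jw) with hT₁
  set T₂ : Matrix (Fin 2) (Fin 2) ℂ := vecMulVec 𝔣.v₀ (star 𝔣.t₀ ᵥ* Jw) with hT₂
  have hν0 : ν ≠ 0 := form_v₀_ne_zero 𝔣
  have hνr : star ν = ν := star_dotProduct_mulVec_self hJ _
  -- the `ℝ`-linear probe
  let X : ℂ →ₗ[ℝ] Matrix (Fin 2) (Fin 2) ℂ :=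
    { toFun := fun z => ν⁻¹ • (z • T₁ - (starRingEnd ℂ z) • T₂)
      map_add' := fun z z' => by rw [map_add, add_smul, add_smul, ← smul_add]; congr 1; abel
      map_smul' := fun r z => by
        simp only [RingHom.id_apply, Complex.real_smul, map_mul, Complex.conj_ofReal, mul_smul, ← smul_sub]
        rw [← Complex.coe_smul, smul_comm] }
  have hXapply : ∀ z, X z = ν⁻¹ • (z • T₁ - (starRingEnd ℂ z) • T₂) := fun z => rfl
  -- adjoints of the two rank-one pieces
  have hT₁H : T₁ᴴ * Jw = Jw * T₂ := by
    rw [hT₁, hT₂, conjTranspose_vecMulVec, star_vecMul, hJ.eq, star_star, vecMulVec_mul, mul_vecMulVec]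
  have hT₂H : T₂ᴴ * Jw = Jw * T₁ := by
    rw [hT₁, hT₂, conjTranspose_vecMulVec, star_vecMul, hJ.eq, star_star, vecMulVec_mul, mul_vecMulVec]
  refine ⟨X, fun z => ?_, fun z => ?_, fun z => ⟨-(ν⁻¹ * (starRingEnd ℂ z) * π), ?_⟩⟩
  · have hνc : (starRingEnd ℂ) ν = ν := by rw [← Complex.star_def]; exact hνr
    rw [hXapply, conjTranspose_smul, conjTranspose_sub, conjTranspose_smul, conjTranspose_smul]
    simp only [Complex.star_def, map_inv₀, hνc, Complex.conj_conj, Matrix.smul_mul, Matrix.mul_smul, Matrix.sub_mul,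
      Matrix.mul_sub, hT₁H, hT₂H]
    module
  · rw [hXapply, Matrix.smul_mulVec, Matrix.sub_mulVec, Matrix.smul_mulVec, Matrix.smul_mulVec, hT₁, hT₂,
      vecMulVec_mulVec_eq_smul, vecMulVec_mulVec_eq_smul, ← dotProduct_mulVec, ← dotProduct_mulVec, 𝔣.orth, zero_smul,
      smul_zero, sub_zero, ← hν, smul_smul, smul_smul, mul_assoc, mul_comm z ν, ← mul_assoc, inv_mul_cancel₀ hν0, one_mul]
  · rw [hXapply, Matrix.smul_mulVec, Matrix.sub_mulVec, Matrix.smul_mulVec, Matrix.smul_mulVec, hT₁, hT₂,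
      vecMulVec_mulVec_eq_smul, vecMulVec_mulVec_eq_smul, ← dotProduct_mulVec, ← dotProduct_mulVec, form_v₀_t₀ 𝔣 hJ,
      zero_smul, smul_zero, zero_sub, ← hπ, smul_smul, smul_neg, smul_smul, ← neg_smul, mul_assoc]

end Exp

section Extension

variable (𝔣 : ConeFrame E J w₁)

/-! ### §4. The cone-open is `U · Stab(ℂ v₀)` -/

include 𝔣 in
/-- **Factorisation `Ω = U · Stab(ℂ v₀)`**: an invertible `g` with `g v₀` negative is `u · b` with `u ∈ U = U(Jw)` and `b` stabilising
the line `ℂ v₀`, with frame coordinates `b v₀ = k v₀`, `b t₀ = a t₀ + d v₀`, `k ≠ 0`, `a ≠ 0` (Witt transitivity ★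
`exists_unitary_mulVec_eq_smul_of_mem_negCone` moves `v₀` to the line of `g v₀`; `b := u⁻¹ g`).  The data are packed in one tuple
`p = (u, b, k, a, d)` so that a single choice function reads them. [cite: Jacobson, Ch. V §11 p. 162] [cite: BergeronMillsonMoeglin2016Balls, Part 2 §1.3] -/
theorem exists_factorisation (hJ : (J.map w₁.1.embedding).IsHermitian) {g : Matrix (Fin 2) (Fin 2) ℂ} (hg : IsUnit g)
    (hgv : g *ᵥ 𝔣.v₀ ∈ negCone (J.map w₁.1.embedding)) :
    ∃ p : archLocal E 2 J w₁ × Matrix (Fin 2) (Fin 2) ℂ × ℂ × ℂ × ℂ,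
      g = ((p.1 : GL (Fin 2) ℂ) : Matrix (Fin 2) (Fin 2) ℂ) * p.2.1 ∧ p.2.2.1 ≠ 0 ∧ p.2.2.2.1 ≠ 0 ∧
        p.2.1 *ᵥ 𝔣.v₀ = p.2.2.1 • 𝔣.v₀ ∧ p.2.1 *ᵥ 𝔣.t₀ = p.2.2.2.1 • 𝔣.t₀ + p.2.2.2.2 • 𝔣.v₀ := by
  obtain ⟨g₀, hg₀, t, ht, hg₀v⟩ := exists_unitary_mulVec_eq_smul_of_mem_negCone hJ 𝔣.v₀_mem hgv
  have hmem : g₀ ∈ archLocal E 2 J w₁ := (mem_archLocal_iff_conjTranspose E 2 J w₁ g₀).2 hg₀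
  set u : archLocal E 2 J w₁ := ⟨g₀, hmem⟩ with hu
  set b : Matrix (Fin 2) (Fin 2) ℂ := ((g₀⁻¹ : GL (Fin 2) ℂ) : Matrix (Fin 2) (Fin 2) ℂ) * g with hb
  have ht0 : (t : ℂ) ≠ 0 := Complex.ofReal_ne_zero.2 ht.ne'
  have hgb : g = (g₀ : Matrix (Fin 2) (Fin 2) ℂ) * b := by
    rw [hb, ← Matrix.mul_assoc, ← Units.val_mul, mul_inv_cancel, Units.val_one, Matrix.one_mul]
  have hbv : b *ᵥ 𝔣.v₀ = (t : ℂ)⁻¹ • 𝔣.v₀ := by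
    have h1 : g *ᵥ 𝔣.v₀ = (t : ℂ)⁻¹ • ((g₀ : Matrix (Fin 2) (Fin 2) ℂ) *ᵥ 𝔣.v₀) := by
      rw [hg₀v, smul_smul, inv_mul_cancel₀ ht0, one_smul]
    rw [hb, ← mulVec_mulVec, h1, mulVec_smul, mulVec_mulVec, ← Units.val_mul, inv_mul_cancel, Units.val_one, one_mulVec]
  obtain ⟨a, d, hbt⟩ := exists_frame_coords_mulVec 𝔣 hJ b
  have hbu : IsUnit b := by
    rw [hb]; exact (Units.isUnit _).mul hg
  have ha : a ≠ 0 := frame_coord_ne_zero_of_isUnit 𝔣 hJ (inv_ne_zero ht0) hbv hbt hbu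
  exact ⟨⟨u, b, (t : ℂ)⁻¹, a, d⟩, hgb, inv_ne_zero ht0, ha, hbv, hbt⟩

/-! ### §5. Two factorisations differ by `K_∞`: the extension is well defined, obeys the cone law, and restricts to `φ` -/

/-- **Consistency.**  If `u b = u' b'` with `u, u' ∈ U` and `b, b'` stabilising `ℂ v₀` (frame coordinates `(k,a,d)`, `(k',a',d')`,
`k, k', a' ≠ 0`), then for every `φ : U → ℂ` with the cotangent `K_∞`-law, `(a k⁻¹) φ u = (a' k'⁻¹) φ u'`: `κ := u⁻¹ u' ∈ U` satisfies
`κ b' = b`, hence stabilises `ℂ v₀` with coordinates `(k∕k', a∕a', ·)`, and `φ u' = φ (u κ) = ((a∕a')(k∕k')⁻¹) φ u`.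
[cite: Borel1997, §5.13–§5.14] -/
theorem factorisation_consistent (φ : archLocal E 2 J w₁ → ℂ)
    (hφ : ∀ (u κ : archLocal E 2 J w₁) (a k d : ℂ), k ≠ 0 →
      ((κ : GL (Fin 2) ℂ) : Matrix (Fin 2) (Fin 2) ℂ) *ᵥ 𝔣.v₀ = k • 𝔣.v₀ →
      ((κ : GL (Fin 2) ℂ) : Matrix (Fin 2) (Fin 2) ℂ) *ᵥ 𝔣.t₀ = a • 𝔣.t₀ + d • 𝔣.v₀ → φ (u * κ) = a * k⁻¹ * φ u)
    {u u' : archLocal E 2 J w₁} {b b' : Matrix (Fin 2) (Fin 2) ℂ} {k a d k' a' d' : ℂ} (hk : k ≠ 0) (hk' : k' ≠ 0)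
    (ha' : a' ≠ 0) (hbv : b *ᵥ 𝔣.v₀ = k • 𝔣.v₀) (hbt : b *ᵥ 𝔣.t₀ = a • 𝔣.t₀ + d • 𝔣.v₀) (hb'v : b' *ᵥ 𝔣.v₀ = k' • 𝔣.v₀)
    (hb't : b' *ᵥ 𝔣.t₀ = a' • 𝔣.t₀ + d' • 𝔣.v₀)
    (h : ((u : GL (Fin 2) ℂ) : Matrix (Fin 2) (Fin 2) ℂ) * b = ((u' : GL (Fin 2) ℂ) : Matrix (Fin 2) (Fin 2) ℂ) * b') :
    a * k⁻¹ * φ u = a' * k'⁻¹ * φ u' := by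
  set κ : archLocal E 2 J w₁ := u⁻¹ * u' with hκ
  have hκM : ((κ : GL (Fin 2) ℂ) : Matrix (Fin 2) (Fin 2) ℂ) =
      (((u : GL (Fin 2) ℂ)⁻¹ : GL (Fin 2) ℂ) : Matrix (Fin 2) (Fin 2) ℂ) * ((u' : GL (Fin 2) ℂ) : Matrix (Fin 2) (Fin 2) ℂ) := by
    rw [hκ, Subgroup.coe_mul, Subgroup.coe_inv, Units.val_mul]
  -- `κ b' = b`
  have hκb : ((κ : GL (Fin 2) ℂ) : Matrix (Fin 2) (Fin 2) ℂ) * b' = b := by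
    rw [hκM, Matrix.mul_assoc, ← h, ← Matrix.mul_assoc, ← Units.val_mul, inv_mul_cancel, Units.val_one, Matrix.one_mul]
  -- frame coordinates of `κ`
  have hκv : ((κ : GL (Fin 2) ℂ) : Matrix (Fin 2) (Fin 2) ℂ) *ᵥ 𝔣.v₀ = (k * k'⁻¹) • 𝔣.v₀ := by
    have h1 : ((κ : GL (Fin 2) ℂ) : Matrix (Fin 2) (Fin 2) ℂ) *ᵥ (b' *ᵥ 𝔣.v₀) = b *ᵥ 𝔣.v₀ := by rw [mulVec_mulVec, hκb]
    rw [hb'v, hbv, mulVec_smul] at h1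
    have h2 := congrArg (fun w => k'⁻¹ • w) h1
    simp only [smul_smul, inv_mul_cancel₀ hk', one_smul] at h2
    rw [h2, mul_comm]
  have hκt : ((κ : GL (Fin 2) ℂ) : Matrix (Fin 2) (Fin 2) ℂ) *ᵥ 𝔣.t₀ =
      (a * a'⁻¹) • 𝔣.t₀ + (a'⁻¹ * (d - d' * (k * k'⁻¹))) • 𝔣.v₀ := by
    have h1 : ((κ : GL (Fin 2) ℂ) : Matrix (Fin 2) (Fin 2) ℂ) *ᵥ (b' *ᵥ 𝔣.t₀) = b *ᵥ 𝔣.t₀ := by rw [mulVec_mulVec, hκb]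
    rw [hb't, hbt, mulVec_add, mulVec_smul, mulVec_smul, hκv, smul_smul] at h1
    -- `a' • κ t₀ = a • t₀ + (d - d' (k/k')) • v₀`
    have h2 : a' • (((κ : GL (Fin 2) ℂ) : Matrix (Fin 2) (Fin 2) ℂ) *ᵥ 𝔣.t₀) = a • 𝔣.t₀ + (d - d' * (k * k'⁻¹)) • 𝔣.v₀ := by
      rw [eq_sub_of_add_eq h1]; module
    have h3 := congrArg (fun w => a'⁻¹ • w) h2
    simp only [smul_add, smul_smul, inv_mul_cancel₀ ha', one_smul] at h3
    rw [h3, mul_comm a'⁻¹ a]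
  -- the `K_∞`-law at `κ`
  have hu' : u' = u * κ := by rw [hκ, mul_inv_cancel_left]
  have hkκ : k * k'⁻¹ ≠ 0 := mul_ne_zero hk (inv_ne_zero hk')
  rw [hu', hφ u κ (a * a'⁻¹) (k * k'⁻¹) _ hkκ hκv hκt]
  field_simp

/-- **THE CONE EXTENSION.**  Every `φ : U → ℂ` with the cotangent `K_∞`-law `φ (u κ) = (a k⁻¹) φ u` (`κ ∈ U`, `κ v₀ = k v₀`,
`κ t₀ = a t₀ + d v₀`) is the restriction of a function `Φ : M₂(ℂ) → ℂ` obeying the CONE LAW of ★ `IsConeHol 𝔣` (its second clause,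
verbatim): `Φ (g b) = (a k⁻¹) Φ g` for `g` invertible with `g v₀` negative and `b v₀ = k v₀` (`k ≠ 0`), `b t₀ = a t₀ + d v₀`.
CONSTRUCTION: `Φ g := (a k⁻¹) φ u` for a chosen factorisation `g = u b` of §4 when `g` lies in the cone-open, `Φ := 0` off it (forced by
the law at `a = 0`); well defined and lawful by `factorisation_consistent` and `frame_coords_mul`. [cite: Borel1997, §5.13–§5.14]
[cite: BergeronMillsonMoeglin2016Balls, Part 2 §1.3] -/
theorem exists_coneExtension (hJ : (J.map w₁.1.embedding).IsHermitian) (φ : archLocal E 2 J w₁ → ℂ)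
    (hφ : ∀ (u κ : archLocal E 2 J w₁) (a k d : ℂ), k ≠ 0 →
      ((κ : GL (Fin 2) ℂ) : Matrix (Fin 2) (Fin 2) ℂ) *ᵥ 𝔣.v₀ = k • 𝔣.v₀ →
      ((κ : GL (Fin 2) ℂ) : Matrix (Fin 2) (Fin 2) ℂ) *ᵥ 𝔣.t₀ = a • 𝔣.t₀ + d • 𝔣.v₀ → φ (u * κ) = a * k⁻¹ * φ u) :
    ∃ Φ : Matrix (Fin 2) (Fin 2) ℂ → ℂ,
      (∀ (g b : Matrix (Fin 2) (Fin 2) ℂ) (a k d : ℂ), IsUnit g → g *ᵥ 𝔣.v₀ ∈ negCone (J.map w₁.1.embedding) → k ≠ 0 →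
        b *ᵥ 𝔣.v₀ = k • 𝔣.v₀ → b *ᵥ 𝔣.t₀ = a • 𝔣.t₀ + d • 𝔣.v₀ → Φ (g * b) = (a * k⁻¹) * Φ g) ∧
      (∀ u : archLocal E 2 J w₁, Φ ((u : GL (Fin 2) ℂ) : Matrix (Fin 2) (Fin 2) ℂ) = φ u) ∧
      ∀ m : Matrix (Fin 2) (Fin 2) ℂ, ¬ (IsUnit m ∧ m *ᵥ 𝔣.v₀ ∈ negCone (J.map w₁.1.embedding)) → Φ m = 0 := by
  classical
  -- the chosen factorisation on the cone-open and the value `λ(b) φ(u)`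
  let P : ∀ m : Matrix (Fin 2) (Fin 2) ℂ, IsUnit m ∧ m *ᵥ 𝔣.v₀ ∈ negCone (J.map w₁.1.embedding) →
      archLocal E 2 J w₁ × Matrix (Fin 2) (Fin 2) ℂ × ℂ × ℂ × ℂ := fun m h => (exists_factorisation 𝔣 hJ h.1 h.2).choose
  have hP : ∀ (m : Matrix (Fin 2) (Fin 2) ℂ) (h : IsUnit m ∧ m *ᵥ 𝔣.v₀ ∈ negCone (J.map w₁.1.embedding)),
      m = (((P m h).1 : GL (Fin 2) ℂ) : Matrix (Fin 2) (Fin 2) ℂ) * (P m h).2.1 ∧ (P m h).2.2.1 ≠ 0 ∧ (P m h).2.2.2.1 ≠ 0 ∧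
        (P m h).2.1 *ᵥ 𝔣.v₀ = (P m h).2.2.1 • 𝔣.v₀ ∧ (P m h).2.1 *ᵥ 𝔣.t₀ = (P m h).2.2.2.1 • 𝔣.t₀ + (P m h).2.2.2.2 • 𝔣.v₀ :=
    fun m h => (exists_factorisation 𝔣 hJ h.1 h.2).choose_spec
  let Φ : Matrix (Fin 2) (Fin 2) ℂ → ℂ := fun m =>
    if h : IsUnit m ∧ m *ᵥ 𝔣.v₀ ∈ negCone (J.map w₁.1.embedding) then
      (P m h).2.2.2.1 * ((P m h).2.2.1)⁻¹ * φ (P m h).1 else 0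
  have hΦpos : ∀ (m : Matrix (Fin 2) (Fin 2) ℂ) (h : IsUnit m ∧ m *ᵥ 𝔣.v₀ ∈ negCone (J.map w₁.1.embedding)),
      Φ m = (P m h).2.2.2.1 * ((P m h).2.2.1)⁻¹ * φ (P m h).1 := fun m h => dif_pos h
  have hΦneg : ∀ m : Matrix (Fin 2) (Fin 2) ℂ, ¬ (IsUnit m ∧ m *ᵥ 𝔣.v₀ ∈ negCone (J.map w₁.1.embedding)) → Φ m = 0 :=
    fun m h => dif_neg h
  refine ⟨Φ, fun g b a k d hg hgv hk hbv hbt => ?_, fun u => ?_, hΦneg⟩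
  · -- the cone law
    by_cases ha : a = 0
    · -- degenerate `b`: `g b` is not invertible, both sides vanish
      rw [ha] at hbt
      have hnb : ¬ IsUnit (g * b) := fun hu => by
        have hdet : IsUnit (g * b).det := (Matrix.isUnit_iff_isUnit_det _).1 hu
        rw [Matrix.det_mul] at hdet
        exact not_isUnit_of_frame_coords_zero 𝔣 hJ hk hbv hbt
          ((Matrix.isUnit_iff_isUnit_det _).2 (isUnit_of_mul_isUnit_right hdet))
      rw [hΦneg _ (fun h => hnb h.1), ha, zero_mul, zero_mul]
    · have hbu : IsUnit b := isUnit_of_frame_coords 𝔣 hJ hk ha hbv hbt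
      have hgb : IsUnit (g * b) ∧ (g * b) *ᵥ 𝔣.v₀ ∈ negCone (J.map w₁.1.embedding) := by
        refine ⟨hg.mul hbu, ?_⟩
        rw [← mulVec_mulVec, hbv, mulVec_smul]
        exact smul_mem_negCone hk hgv
      have hg' : IsUnit g ∧ g *ᵥ 𝔣.v₀ ∈ negCone (J.map w₁.1.embedding) := ⟨hg, hgv⟩
      rw [hΦpos _ hgb, hΦpos _ hg']
      obtain ⟨h1, hk1, ha1, hv1, ht1⟩ := hP g hg'
      obtain ⟨h2, hk2, _, hv2, ht2⟩ := hP (g * b) hgb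
      -- `g b = u₂ b₂ = u₁ (b₁ b)`
      obtain ⟨hv3, ht3⟩ := frame_coords_mul 𝔣 hv1 ht1 hbv hbt
      have heq : (((P (g * b) hgb).1 : GL (Fin 2) ℂ) : Matrix (Fin 2) (Fin 2) ℂ) * (P (g * b) hgb).2.1 =
          (((P g hg').1 : GL (Fin 2) ℂ) : Matrix (Fin 2) (Fin 2) ℂ) * ((P g hg').2.1 * b) := by
        rw [← h2, ← Matrix.mul_assoc, ← h1]
      rw [factorisation_consistent 𝔣 φ hφ hk2 (mul_ne_zero hk1 hk) (mul_ne_zero ha1 ha) hv2 ht2 hv3 ht3 heq]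
      field_simp
  · -- restriction to `U`
    have hu : IsUnit (((u : GL (Fin 2) ℂ) : Matrix (Fin 2) (Fin 2) ℂ)) ∧
        ((u : GL (Fin 2) ℂ) : Matrix (Fin 2) (Fin 2) ℂ) *ᵥ 𝔣.v₀ ∈ negCone (J.map w₁.1.embedding) :=
      isUnit_and_mulVec_mem_negCone 𝔣 u
    rw [hΦpos _ hu]
    obtain ⟨h1, hk1, _, hv1, ht1⟩ := hP _ hu
    have heq : (((P _ hu).1 : GL (Fin 2) ℂ) : Matrix (Fin 2) (Fin 2) ℂ) * (P _ hu).2.1 =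
        ((u : GL (Fin 2) ℂ) : Matrix (Fin 2) (Fin 2) ℂ) * 1 := by rw [Matrix.mul_one, ← h1]
    rw [factorisation_consistent 𝔣 φ hφ hk1 one_ne_zero one_ne_zero hv1 ht1 (frame_coords_one 𝔣).1 (frame_coords_one 𝔣).2
      heq, inv_one, mul_one, one_mul]

end Extension

end Literature.AlgebraicGeometry.ShimuraVarieties.UnitaryCurveCone

end
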